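import Literature.NumberTheory.Automorphic.ResGLnCuspidalCohomologyApexIrreducible
import HarnessLib

/-!
# Clozel's Lemme 3.14/3.15 (the apex fact) from the archimedean statement in generic
# `(𝔤, K)`-module vocabulary (no automorphy datum)

Topic `NumberTheory/Automorphic`; namespace `Literature.NumberTheory.Automorphic.ConeDictionary`;
one theorem (no definition, no named fact, no `sorry`).

`ResGLnCuspidalCohomologyApexIrreducible` reduced the apex fact
`ConeDictionary.Clozel1990_exists_basic_levelFixed_cocycle` to the existence half of the
Vogan–Zuckerman / Salamanca-Riba theory for IRREDUCIBLE unitary `(𝔤, K_∞)`-modules of `GL_n(K_∞)`,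
phrased over the archimedean group `(AutomorphyDatum.gl n K hcpt).arch` of the automorphy datum and the
cone-dictionary complex `gkComplexV`.  Here the same hypothesis is re-typed in the GENERIC vocabulary of
the archimedean theory — the linear real group `archGroupGL n K = GL_n(K ⊗_ℚ ℝ)` (`AdelicGLnGlue`), its
`(𝔤, K_∞)`-modules (`GKModules`), the coefficient modules `E_λ(ℂ) ⊗ ε_S`
(`ResGLnCohomology.archCoeffRepSign`, `archCoeffLie`), the tensor product `(𝔤, K_∞)`-module (`GKTensor`)
and its `(𝔤, K_∞)`-cohomology (`gkCohomology`, `GKCohomology`) — with no reference to the adelic side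
(no `isCompact_glFiniteIntegralLevel`, no automorphy datum): this is the form in which the archimedean
theorem is printed and should be vendored.  The two phrasings agree definitionally
(`AutomorphyDatum.gl_arch`, `ConeDictionary.σS`, `σSK`, `σ𝔤S` are re-typings), so the theorem is a
one-line specialisation of `Clozel1990_exists_basic_levelFixed_cocycle_of_irreducible_unitary_gkCohomology`.
[cite: Clozel1990, Lemme 3.14 (p. 114), Lemme 3.15 (p. 121)] [cite: VoganZuckerman1984, Thm. 5.5, Thm. 5.6]
[cite: SalamancaRiba1999, main theorem] [cite: BorelWallach2000, VI Thm. 5.3–5.4, I §5.1, §1.3]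

## References

* L. Clozel, *Motifs et formes automorphes* (1990), Lemme 3.14 (p. 114), Lemme 3.15 (p. 121). [Clozel1990]
* D. A. Vogan, G. J. Zuckerman, Compositio Math. 53 (1984), Thm. 5.5 (p. 74), 5.6 (p. 75). [VoganZuckerman1984]
* S. A. Salamanca-Riba, Duke Math. J. 96 (1999), main theorem. [SalamancaRiba1999]
* A. Borel, N. Wallach (2000), I §1.3, §5.1, VI 5.3–5.4 (held). [BorelWallach2000]
-/

noncomputable section

-- Mathlib idiom (Mathlib/Algebra/Lie/OfAssociative.lean), as in `GKModules`: the commutator bracket on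
-- `Module.End ℂ V`, needed to speak of `𝔤 →ₗ⁅ℝ⁆ Module.End ℂ V` in the hypothesis
attribute [local instance 100] LieRing.ofAssociativeRing

open scoped TensorProduct Classical _root_.Matrix
open _root_.NumberField _root_.NumberField.InfinitePlace _root_.NumberField.mixedEmbedding IsDedekindDomain

namespace Literature.NumberTheory.Automorphic

namespace ConeDictionary

open ResGLnCohomology RealMatrixGroup Literature.NumberTheory.DiophantineGeometry Literature.Barriers.Langlands

set_option maxHeartbeats 800000 in
-- the re-typing over the datum is definitional but deep
/-- **The apex fact from the archimedean theorem in generic vocabulary.**  If every irreducible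
admissible `(𝔤, K_∞)`-module `(V, ρK, ρ𝔤)` of `archGroupGL n K = GL_n(K_∞)` (`n ≥ 2`) with a
`K_∞`-invariant positive definite Hermitian form for which the `X ∈ 𝔤` of norm exponent
`∑_{v real} tr X_v + ∑_{v complex} 2 re tr X_v = 0` act skew-adjointly, and with the archimedean parameter
`σ ↦ {λ^∨_{σ,i} + ρ_i}` of `E_λ^∨` (`λ` dominant), has
`H^q(𝔤, K_∞; V ⊗ (E_λ(ℂ) ⊗ ε_S)) ≠ 0` (`gkCohomology` of the `GKTensor` module) for some set `S` of real
places and some `q`, then `Clozel1990_exists_basic_levelFixed_cocycle` holds.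
[cite: Clozel1990, Lemme 3.14 (p. 114), Lemme 3.15 (p. 121)] [cite: VoganZuckerman1984, Thm. 5.5, Thm. 5.6]
[cite: SalamancaRiba1999, main theorem] [cite: BorelWallach2000, VI Thm. 5.3–5.4, I §5.1] -/
theorem Clozel1990_exists_basic_levelFixed_cocycle_of_archGroupGL_gkCohomology
    (H : ∀ (n : ℕ) (K : Type) [Field K] [NumberField K] (lam : (K →+* ℂ) → Fin n → ℤ),
      2 ≤ n → (∀ τ, Weight.IsDominant (lam τ)) →
      ∀ (V : Type) [AddCommGroup V] [Module ℂ V]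
        (ρK : Representation ℂ (archGroupGL n K).maximalCompact V)
        (ρ𝔤 : (archGroupGL n K).lie →ₗ⁅ℝ⁆ Module.End ℂ V)
        (hV : IsGKModule (archGroupGL n K) ρK ρ𝔤),
        IsIrreducibleGK ρK ρ𝔤 → IsAdmissibleGK ρK →
        (∃ ip : V → V → ℂ, Kuga.IsPosForm ip ∧
          (∀ (k : (archGroupGL n K).maximalCompact) (v w : V), ip (ρK k v) (ρK k w) = ip v w) ∧
          ∀ X : (archGroupGL n K).lie,
            ((∑ w, (X : Matrix (Fin n) (Fin n) (mixedSpace K)).trace.1 w) +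
                ∑ w, 2 * ((X : Matrix (Fin n) (Fin n) (mixedSpace K)).trace.2 w).re) = 0 →
            ∀ v w : V, ip (ρ𝔤 X v) w = -ip v (ρ𝔤 X w)) →
        HasArchParameter
          (ρ𝔤.comp (LieSubalgebra.topEquiv :
            (⊤ : LieSubalgebra ℝ (Matrix (Fin n) (Fin n) (mixedSpace K))) ≃ₗ⁅ℝ⁆
              Matrix (Fin n) (Fin n) (mixedSpace K)).symm.toLieHom)
          (fun σ ↦ (cohomologicalInfinityType n K (Weight.dual (lam σ)) σ).map ArchWeight.a) →
        ∃ (S : Finset {w : InfinitePlace K // w.IsReal}) (q : ℕ),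
          Nontrivial (gkCohomology (archGroupGL n K)
            (ρK.tprod (RealMatrixGroup.restrictK (archGroupGL n K) (archCoeffRepSign n K S lam)))
            (GKTensor.lie (archGroupGL n K) ρ𝔤 (archCoeffLie n K lam))
            (GKTensor.ad_compat (archGroupGL n K) ρK ρ𝔤
              (RealMatrixGroup.restrictK (archGroupGL n K) (archCoeffRepSign n K S lam)) (archCoeffLie n K lam)
              hV.ad_compat (isGKModule_archCoeffSign n K S lam).ad_compat) q)) :
    Clozel1990_exists_basic_levelFixed_cocycle :=
  Clozel1990_exists_basic_levelFixed_cocycle_of_irreducible_unitary_gkCohomology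
    fun n K _ _ _hcpt lam hn hdom V _ _ ρK ρ𝔤 hV hirr hadm hform hpar =>
      H n K lam hn hdom V ρK ρ𝔤 hV hirr hadm hform hpar

end ConeDictionary

end Literature.NumberTheory.Automorphic

end
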